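import Literature.Geometry.ComplexAnalytic.PhamBrieskornMilnorNumber
import Literature.Geometry.ComplexAnalytic.PhamBrieskornCyclicNodeMilnorNumber
import Literature.Geometry.ComplexAnalytic.PhamBrieskornFibreSymmetries
import Literature.AlgebraicTopology.SingularHomology.BettiNumberBaseChange
import Mathlib.RingTheory.RootsOfUnity.PrimitiveRoots
import HarnessLib

/-!
# The covering rotation of the Pham–Brieskorn fibre is killed by `1 + τ + ⋯ + τ^{m−1}` on `Hₙ₊₁(F)`, and the
# rational Betti number of `F` (Milnor 1968 §9; Carlson–Toledo 1999 §6: "eigenvalues the `k`-th roots of unity `μ ≠ 1`")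

Sequel of `PhamBrieskornFibreSymmetries` (the rotation `rotateFibre v` of the last coordinate of the affine Milnor
fibre `F = {Σ zᵢ^{aᵢ} = 1}` has no invariant vector on `Hₙ₊₁(F)`) and `PhamBrieskornMilnorNumber`
(`dim_ℂ Hₙ₊₁(F; ℂ) = Π (aᵢ − 1)`, Milnor Thm. 9.1). On the tree's carriers, for every coefficient field of
characteristic zero:

* `rotateFibre_mul`, `rotateFibre_one` — the rotations form a homomorphism `Ω_{aₙ₊₁} → Homeo(F)`;
* **`sum_pow_map_rotateFibre_eq_zero`** — for a PRIMITIVE `aₙ₊₁`-th root of unity `ζ` and `τ = (rotateFibre ζ)_*`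
  on `Hₙ₊₁(F)`: `Σ_{i < aₙ₊₁} τ^i x = 0` for every class `x` (the sum is invariant under all rotations — every
  `v ∈ Ω_{aₙ₊₁}` is a power of `ζ` — hence zero): Carlson–Toledo's "eigenvalues the `k`-th roots of unity `μ ≠ 1`"
  / the clause `Σ_{i<p} τ^i δ = 0` of the tree's cyclic reflection systems;
* `finrank_rat_singularHomology_fibre` — **`dim_ℚ Hₙ₊₁(F; ℚ) = Π (aᵢ − 1)`** (universal coefficients,
  `bettiNumber_eq_of_algebra`), `finite_rat_singularHomology_fibre` (when all `aᵢ ≥ 2`); for the cyclic node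
  `(2, 2, p)`: `finrank_rat_singularHomology_fibre_cyclicNode` — `dim_ℚ H₂(F; ℚ) = p − 1`.

With `CyclicReflectionSystemSpanRank.finrank_cyclicSpan_of_sum_pow_apply_eq_zero` (tree: `dim ℚ[τ]δ = p − 1` from
`Σ_{i<p} τ^i δ = 0`, `δ ≠ 0`, `p` prime) this yields the full `ℚ[τ]`-structure of the local vanishing homology of
the cyclic node: `H₂(F; ℚ) = ℚ[τ]·δ ≅ ℚ(ζ_p)` for any `δ ≠ 0` (the clauses `δ ≠ 0`, `Σ τ^i δ = 0`,
`dim ℚ[τ]δ = p − 1` of the cited fact `carlsonToledo1999_nodalMeridianMonodromy_isCyclicReflection`, read on the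
local model). Everything is proved; no definition, no named fact.

## References

* [Milnor1968] J. Milnor, Singular Points of Complex Hypersurfaces, Ann. of Math. Studies 61 (1968), §9, Thm. 9.1,
  Lemma 9.2 and p. 77.
* [CarlsonToledo1999] J. A. Carlson, D. Toledo, Duke Math. J. 97 (1999), §6 (held text p0013).
* [HatcherAT2002] A. Hatcher, Algebraic Topology, CUP 2002, §3.A Thm. 3A.3 (universal coefficients).
-/

noncomputable section

open Complex ContinuousMap Set Filter CategoryTheory Limits
open Literature.AlgebraicTopology.SingularHomology
open scoped unitInterval Topology

namespace Literature.Geometry.ComplexAnalytic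

namespace PhamBrieskorn

/-! ### The rotations form a homomorphism -/

section Hom

variable {n : ℕ} (a : Fin (n + 1) → ℕ) (ha : ∀ i, a i ≠ 0)

/-- `rotateFibre v ∘ rotateFibre w = rotateFibre (v w)`. [cite: Milnor1968, §9 p. 77] -/
theorem rotateFibre_mul (v w : Omega (a (Fin.last n))) :
    (rotateFibre a ha v : C(fibre a, fibre a)).comp (rotateFibre a ha w : C(fibre a, fibre a)) =
      (rotateFibre a ha ⟨(v : ℂ) * w, mul_mem_Omega v.2 w.2⟩ : C(fibre a, fibre a)) := by
  ext z : 1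
  refine Subtype.ext ?_
  change rotateFun (v : ℂ) (rotateFun (w : ℂ) (z : Fin (n + 1) → ℂ)) = rotateFun ((v : ℂ) * w) (z : Fin (n + 1) → ℂ)
  rw [rotateFun_rotateFun]

/-- `rotateFibre 1 = id`. [cite: Milnor1968, §9 p. 77] -/
theorem rotateFibre_one :
    (rotateFibre a ha ⟨1, one_mem_Omega _⟩ : C(fibre a, fibre a)) = ContinuousMap.id _ := by
  ext z : 1
  refine Subtype.ext ?_
  change rotateFun (1 : ℂ) (z : Fin (n + 1) → ℂ) = (z : Fin (n + 1) → ℂ)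
  rw [rotateFun_one]

/-- Powers: `(rotateFibre ζ)_*^i = (rotateFibre ζ^i)_*` on homology. [cite: Milnor1968, §9 p. 77] -/
theorem map_rotateFibre_pow (R : Type) [CommRing R] (ζ : Omega (a (Fin.last n))) (b : ℕ) (i : ℕ) :
    (singularHomology.map R R (rotateFibre a ha ζ : C(fibre a, fibre a)) b).hom ^ i =
      (singularHomology.map R R (rotateFibre a ha ⟨(ζ : ℂ) ^ i, by
        rw [mem_Omega, ← pow_mul, mul_comm, pow_mul, (mem_Omega.1 ζ.2), one_pow]⟩ : C(fibre a, fibre a)) b).hom := by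
  induction i with
  | zero =>
    rw [pow_zero]
    have h1 : (⟨(ζ : ℂ) ^ 0, by rw [mem_Omega, ← pow_mul, mul_comm, pow_mul, (mem_Omega.1 ζ.2), one_pow]⟩ :
        Omega (a (Fin.last n))) = ⟨1, one_mem_Omega _⟩ := Subtype.ext (pow_zero _)
    rw [h1, rotateFibre_one, singularHomology.map_id]
    rfl
  | succ i ih =>
    rw [pow_succ, ih, Module.End.mul_eq_comp, ← ModuleCat.hom_comp, ← singularHomology.map_comp, rotateFibre_mul]
    have h2 : (⟨((⟨(ζ : ℂ) ^ i, by
          rw [mem_Omega, ← pow_mul, mul_comm, pow_mul, (mem_Omega.1 ζ.2), one_pow]⟩ : Omega (a (Fin.last n))) : ℂ) * ζ,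
          mul_mem_Omega (by rw [mem_Omega, ← pow_mul, mul_comm, pow_mul, (mem_Omega.1 ζ.2), one_pow]) ζ.2⟩ :
          Omega (a (Fin.last n))) =
        ⟨(ζ : ℂ) ^ (i + 1), by rw [mem_Omega, ← pow_mul, mul_comm, pow_mul, (mem_Omega.1 ζ.2), one_pow]⟩ :=
      Subtype.ext (pow_succ (ζ : ℂ) i).symm
    rw [h2]

end Hom

/-! ### `Σ_{i < m} τ^i = 0` on `Hₙ₊₁(F)` for a primitive root -/

section Sum

variable (F : Type) [Field F] [CharZero F] {n : ℕ} {a : Fin (n + 2) → ℕ} (ha : ∀ i, a i ≠ 0)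

/-- **`Σ_{i < aₙ₊₁} τ^i x = 0` on `Hₙ₊₁(F)`** for `τ = (rotateFibre ζ)_*`, `ζ` a PRIMITIVE `aₙ₊₁`-th root of unity:
the sum is fixed by `τ`, hence by every rotation (each `v ∈ Ω_{aₙ₊₁}` is a power of `ζ`), hence zero
(`eq_zero_of_forall_map_rotateFibre_eq`). Carlson–Toledo §6: on the vanishing homology the covering rotation has
"eigenvalues the `k`-th roots of unity `μ ≠ 1`". [cite: CarlsonToledo1999, §6 (held text p0013)]
[cite: Milnor1968, §9 Thm. 9.1 and p. 77] -/
theorem sum_pow_map_rotateFibre_eq_zero {ζ : ℂ} (hζ : IsPrimitiveRoot ζ (a (Fin.last (n + 1))))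
    (x : singularHomology F F (fibre a) (n + 1)) :
    ∑ i ∈ Finset.range (a (Fin.last (n + 1))),
      ((singularHomology.map F F (rotateFibre a ha ⟨ζ, hζ.pow_eq_one⟩ : C(fibre a, fibre a)) (n + 1)).hom ^ i) x = 0 := by
  set m := a (Fin.last (n + 1)) with hm
  set τ := (singularHomology.map F F (rotateFibre a ha ⟨ζ, hζ.pow_eq_one⟩ : C(fibre a, fibre a)) (n + 1)).hom with hτ
  set s := ∑ i ∈ Finset.range m, (τ ^ i) x with hs
  have hτm : τ ^ m = 1 := by
    rw [hτ, map_rotateFibre_pow]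
    have h1 : (⟨ζ ^ m, by rw [mem_Omega, ← pow_mul, mul_comm, pow_mul, hζ.pow_eq_one, one_pow]⟩ :
        Omega (a (Fin.last (n + 1)))) = ⟨1, one_mem_Omega _⟩ := Subtype.ext hζ.pow_eq_one
    rw [h1, rotateFibre_one, singularHomology.map_id]
    rfl
  -- `τ s = s` (shift the summation index modulo `m`)
  have hτs : τ s = s := by
    have key : ∑ i ∈ Finset.range m, (τ ^ (i + 1)) x + (τ ^ 0) x =
        ∑ i ∈ Finset.range m, (τ ^ i) x + (τ ^ m) x := by
      rw [← Finset.sum_range_succ' (fun i => (τ ^ i) x), Finset.sum_range_succ]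
    rw [pow_zero, hτm] at key
    rw [hs, map_sum]
    have h : ∀ i ∈ Finset.range m, τ ((τ ^ i) x) = (τ ^ (i + 1)) x := fun i _ => by
      rw [pow_succ', Module.End.mul_apply]
    rw [Finset.sum_congr rfl h]
    exact add_right_cancel key
  -- hence `τ^j s = s` for all `j`, so every rotation fixes `s`
  have hpow : ∀ j : ℕ, (τ ^ j) s = s := by
    intro j
    induction j with
    | zero => rw [pow_zero, Module.End.one_apply]
    | succ j ih => rw [pow_succ', Module.End.mul_apply, ih, hτs]
  haveI : NeZero m := ⟨ha _⟩
  refine eq_zero_of_forall_map_rotateFibre_eq F ha s fun v => ?_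
  obtain ⟨j, -, hj⟩ := hζ.eq_pow_of_pow_eq_one (mem_Omega.1 v.2)
  have hv : v = ⟨ζ ^ j, by rw [mem_Omega, ← pow_mul, mul_comm, pow_mul, hζ.pow_eq_one, one_pow]⟩ := Subtype.ext hj.symm
  rw [hv]
  have h := hpow j
  rw [hτ, map_rotateFibre_pow] at h
  exact h

end Sum

/-! ### Rational Betti numbers -/

section Rational

variable {n : ℕ} {a : Fin (n + 2) → ℕ} (ha : ∀ i, a i ≠ 0)

include ha in
/-- **`dim_ℚ Hₙ₊₁(F; ℚ) = Π (aᵢ − 1)`** (Milnor Thm. 9.1 over `ℂ` and universal coefficients).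
[cite: Milnor1968, §9 Thm. 9.1] [cite: HatcherAT2002, §3.A Thm. 3A.3] -/
theorem finrank_rat_singularHomology_fibre :
    Module.finrank ℚ (singularHomology ℚ ℚ (fibre a) (n + 1)) = ∏ i, (a i - 1) := by
  rw [← finrank_singularHomology_fibre ha]
  exact bettiNumber_eq_of_algebra ℚ ℂ (fibre a) (n + 1)

include ha in
/-- `Hₙ₊₁(F; ℚ)` is finite-dimensional when all exponents are `≥ 2` (its dimension `Π (aᵢ − 1)` is positive).
[cite: Milnor1968, §9 Thm. 9.1] -/
theorem finite_rat_singularHomology_fibre (h2 : ∀ i, 2 ≤ a i) :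
    Module.Finite ℚ (singularHomology ℚ ℚ (fibre a) (n + 1)) := by
  refine Module.finite_of_finrank_pos ?_
  rw [finrank_rat_singularHomology_fibre ha]
  exact Finset.prod_pos fun i _ => by have := h2 i; omega

/-- **The cyclic node: `dim_ℚ H₂(F; ℚ) = p − 1`** for `F = {z₀² + z₁² + z₂^p = 1}`, `p ≠ 0`.
[cite: Milnor1968, §9 Thm. 9.1] [cite: CarlsonToledo1999, §6 (held text p0013)] -/
theorem finrank_rat_singularHomology_fibre_cyclicNode (p : ℕ) (hp : p ≠ 0) :
    Module.finrank ℚ (singularHomology ℚ ℚ (fibre (cyclicNodeExponents p)) 2) = p - 1 := by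
  rw [← finrank_singularHomology_fibre_cyclicNode p hp]
  exact bettiNumber_eq_of_algebra ℚ ℂ (fibre (cyclicNodeExponents p)) 2

end Rational

end PhamBrieskorn

end Literature.Geometry.ComplexAnalytic

end
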